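import Summits.CriticalPhenomena.SAWScalingLimit.Theorems.SAWTensorRGRestrictionOfLimitOfDiscContinuity

/-!
# Hull restriction of the SAW scaling limit from OUTER domain continuity AWAY FROM THE MARKED POINTS

Support file (`--supports stmt-CriticalPhenomena-0773`, registered stub
`stub_isHullRestrictionOfOuterDiscContinuityAwayFromMarks`) of the line `birth` for the crux `RestrictionOfLimit`
(stmt-CriticalPhenomena-0773). The sibling file `SAWTensorRGRestrictionOfLimitOfDiscContinuity.lean` proves
`DiscContinuity → RestrictionOfLimit` for ALL pairs `D' ⊆ D`. This file records the sharper dependency for the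
HULL-NARROWED crux (the form every refuter note recommends, `ChordalFamily.IsHullRestriction`, LSW03's actual
hypothesis `a, b ∉ closure (D ∖ D')`): it needs domain continuity of the scaling limit only along OUTER
approximations `D_n ⊇ D` that AGREE WITH `D` NEAR THE MARKED POINTS — the part of `DiscContinuity`
(stmt-CriticalPhenomena-6755) that does not touch the behaviour of the walk at its tips. Reason: for a hull pair the
Radó squeeze `E t` of `D'` inside `D` (`stub_radoSqueezeFamily`) sits between `D'` and `D`, which coincide on balls
about `a` and `b`.

The weakened continuity is taken as an explicit, fully unfolded hypothesis (no new definition); the conclusion is the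
Literature predicate `ChordalFamily.IsHullRestriction`. No named fact; axioms `propext`, `Classical.choice`,
`Quot.sound`.
-/

noncomputable section

open MeasureTheory Filter Topology Set Metric
open scoped ENNReal NNReal BoundedContinuousFunction
open Literature.Probability.RandomPlanarGeometry Literature.Probability.LatticeModels

namespace Summit.CriticalPhenomena.SAWScalingLimit.Theorems.RestrictionOfLimit.Birth

/-- For a hull sub-domain, `D` and `D'` coincide on small balls about the marked points. [folklore] -/
theorem exists_ball_inter_eq_of_isHullSubdomain {D D' : DobrushinDomain} (hH : D.IsHullSubdomain D') :
    ∃ r : ℝ, 0 < r ∧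
      D.carrier ∩ (ball (D.pt 0) r ∪ ball (D.pt 1) r) = D'.carrier ∩ (ball (D.pt 0) r ∪ ball (D.pt 1) r) := by
  obtain ⟨hsub, -, -, ha, hb⟩ := hH
  have key : ∀ p : ℂ, p ∉ closure (D.carrier \ D'.carrier) →
      ∃ r : ℝ, 0 < r ∧ ball p r ∩ (D.carrier \ D'.carrier) = ∅ := by
    intro p hp
    have hmem : (closure (D.carrier \ D'.carrier))ᶜ ∈ 𝓝 p := isClosed_closure.isOpen_compl.mem_nhds hp
    obtain ⟨r, hr, hball⟩ := Metric.mem_nhds_iff.1 hmem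
    refine ⟨r, hr, Set.eq_empty_iff_forall_notMem.2 fun x hx => ?_⟩
    exact hball hx.1 (subset_closure hx.2)
  obtain ⟨ra, hra, hA⟩ := key _ ha
  obtain ⟨rb, hrb, hB⟩ := key _ hb
  refine ⟨min ra rb, lt_min hra hrb, Set.Subset.antisymm ?_ ?_⟩
  · rintro x ⟨hxD, hxU⟩
    refine ⟨?_, hxU⟩
    by_contra hxD'
    rcases hxU with hxa | hxb
    · have : x ∈ ball (D.pt 0) ra ∩ (D.carrier \ D'.carrier) :=
        ⟨ball_subset_ball (min_le_left _ _) hxa, hxD, hxD'⟩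
      rw [hA] at this
      exact this
    · have : x ∈ ball (D.pt 1) rb ∩ (D.carrier \ D'.carrier) :=
        ⟨ball_subset_ball (min_le_right _ _) hxb, hxD, hxD'⟩
      rw [hB] at this
      exact this
  · exact Set.inter_subset_inter_left _ hsub

/-- **Registered stub `stub_isHullRestrictionOfOuterDiscContinuityAwayFromMarks` — hull restriction from outer
domain continuity away from the marked points.** HYPOTHESIS (fully unfolded): for every chordal family `P` which is the
full scaling limit of the critical `δℤ²` SAW, and all Dobrushin `D_n`, `D` with closed-disc uniformizers `Φ_n → Φ`
uniformly on the closed unit disc (marked points `Φ_n (∓1)`, `Φ (∓1)`) such that, IN ADDITION, `D ⊆ D_n` for all `n`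
(outer approximation) and `D_n`, `D` agree on fixed balls about the two marked points of `D`, the laws converge:
`∫ f dP(D_n) → ∫ f dP(D)` for bounded continuous `f`. CONCLUSION: every full scaling-limit family `P` has the
restriction property over hull sub-domains (`ChordalFamily.IsHullRestriction`). Proof: for a hull pair `(D, D')` the
Radó squeeze `E t` (`stub_radoSqueezeFamily`) satisfies `D' ⊆ E t ⊆ D`, and `D`, `D'` coincide near `a`, `b`
(`exists_ball_inter_eq_of_isHullSubdomain`), so the hypothesis gives `P (E t) ⇒ P D'` along `t → 0⁺` (sequences made
positive, as in `tendsto_integral_of_discContinuity`), and `stub_restrictionOfSqueeze` concludes. [folklore] -/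
theorem stub_isHullRestrictionOfOuterDiscContinuityAwayFromMarks :
    (∀ P : ChordalFamily, P.IsChordal →
      (∀ (D : DobrushinDomain) (a b : ℝ → Site 2), SAW.IsEndpointApprox D a b →
        TendstoLaw (fun δ (γ : SAW.DomainSAW D.carrier δ (a δ) (b δ)) => γ.curve)
          (fun δ => SAW.law D.carrier δ (a δ) (b δ)) id (P D)) →
      ∀ (Dn : ℕ → DobrushinDomain) (D : DobrushinDomain) (Φn : ℕ → C(ℂ, ℂ)) (Φ : C(ℂ, ℂ)),
        (∀ n, ∃ g : ConformalEquiv (Metric.ball (0 : ℂ) 1) (Dn n).carrier,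
          Set.EqOn (Φn n) g (Metric.ball (0 : ℂ) 1)) →
        (∃ g : ConformalEquiv (Metric.ball (0 : ℂ) 1) D.carrier, Set.EqOn Φ g (Metric.ball (0 : ℂ) 1)) →
        (∀ n, (Dn n).pt 0 = Φn n (-1) ∧ (Dn n).pt 1 = Φn n 1) → D.pt 0 = Φ (-1) → D.pt 1 = Φ 1 →
        TendstoUniformlyOn (fun n => ((Φn n : C(ℂ, ℂ)) : ℂ → ℂ)) (Φ : ℂ → ℂ) Filter.atTop
          (Metric.closedBall (0 : ℂ) 1) →
        (∀ n, D.carrier ⊆ (Dn n).carrier) →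
        (∃ r : ℝ, 0 < r ∧ ∀ n, (Dn n).carrier ∩ (Metric.ball (D.pt 0) r ∪ Metric.ball (D.pt 1) r) =
          D.carrier ∩ (Metric.ball (D.pt 0) r ∪ Metric.ball (D.pt 1) r)) →
        ∀ f : CurveClass ℂ →ᵇ ℝ,
          Tendsto (fun n => ∫ γ, f γ ∂(P (Dn n))) Filter.atTop (𝓝 (∫ γ, f γ ∂(P D)))) →
    ∀ P : ChordalFamily, SAW.IsScalingLimitFamily P → P.IsHullRestriction := by
  intro hW P hP D D' hH T hT
  have hH' := hH
  obtain ⟨hsub, h0, h1, -, -⟩ := hH'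
  obtain ⟨E, hN, hS, hX, Φt, Φ, hΦt, hΦ, hmk, h0', h1', hunif⟩ := stub_radoSqueezeFamily D D' hsub h0 h1
  -- `D` and `D'` (hence every `E t`) agree near the marked points
  obtain ⟨r, hr, hball⟩ := exists_ball_inter_eq_of_isHullSubdomain hH
  have hagree : ∀ t : ℝ, 0 < t →
      (E t).carrier ∩ (ball (D'.pt 0) r ∪ ball (D'.pt 1) r) =
        D'.carrier ∩ (ball (D'.pt 0) r ∪ ball (D'.pt 1) r) := by
    intro t ht
    rw [h0, h1]
    refine Set.Subset.antisymm ?_ (Set.inter_subset_inter_left _ (hN t ht).1)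
    rw [← hball]
    exact Set.inter_subset_inter_left _ (hN t ht).2.1
  -- weak continuity of `P` along the squeeze, from the hypothesis
  have hcont : ∀ f : CurveClass ℂ →ᵇ ℝ,
      Tendsto (fun t : ℝ => ∫ γ, f γ ∂(P (E t))) (𝓝[>] (0 : ℝ)) (𝓝 (∫ γ, f γ ∂(P D'))) := by
    intro f
    rw [Filter.tendsto_iff_seq_tendsto]
    intro u hu
    have hu_pos : ∀ᶠ n in atTop, 0 < u n :=
      (hu.eventually (eventually_mem_nhdsWithin (a := (0 : ℝ)) (s := Ioi 0))).mono fun n hn => hn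
    set u' : ℕ → ℝ := fun n => if 0 < u n then u n else 1 with hu'_def
    have hu'_pos : ∀ n, 0 < u' n := fun n => by
      simp only [hu'_def]
      split_ifs with h
      · exact h
      · exact one_pos
    have hu'_eq : ∀ᶠ n in atTop, u' n = u n := hu_pos.mono fun n hn => by simp [hu'_def, hn]
    have hu' : Tendsto u' atTop (𝓝[>] (0 : ℝ)) := hu.congr' (hu'_eq.mono fun n hn => hn.symm)
    have hunif' : TendstoUniformlyOn (fun n => ((Φt (u' n) : C(ℂ, ℂ)) : ℂ → ℂ)) (Φ : ℂ → ℂ) atTop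
        (Metric.closedBall (0 : ℂ) 1) := by
      rw [Metric.tendstoUniformlyOn_iff] at hunif ⊢
      intro ε hε
      exact hu'.eventually (hunif ε hε)
    have key := hW P hP.1 hP.2 (fun n => E (u' n)) D' (fun n => Φt (u' n)) Φ
      (fun n => hΦt (u' n) (hu'_pos n)) hΦ (fun n => hmk (u' n) (hu'_pos n)) h0' h1' hunif'
      (fun n => (hN (u' n) (hu'_pos n)).1) ⟨r, hr, fun n => hagree (u' n) (hu'_pos n)⟩ f
    refine key.congr' (hu'_eq.mono fun n hn => ?_)
    simp only [Function.comp_apply, hn]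
  exact stub_restrictionOfSqueeze P hP D D' E hN hS hX hcont T hT

end Summit.CriticalPhenomena.SAWScalingLimit.Theorems.RestrictionOfLimit.Birth

end
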